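import Summits.PneNP.PneNP.Theorems.SymmetryBudgetWindowHamCruxLinks
import Summits.PneNP.PneNP.Theorems.SymmetryBudgetWindowHamConjectureWeb
import Literature.Barriers.PneNP.NaturalProofsHardPRGStrength
import HarnessLib

/-!
# `WindowHam` under the natural-proofs hypothesis: true, and not naturally provable

Route `PneNP/SymmetryBudget`, crux `WindowHam` (item stmt-PneNP-2143), which is `NP ⊄ P/poly` under
the kernel-checked equivalence `windowHam_iff_not_np_subset_PPoly`
(`SymmetryBudgetWindowHamIffNPNotSubsetPPoly.lean`). The barrier placement of the crux
(`windowHam_naturalProofs_barrier`, `SymmetryBudgetWindowHamConjectureWeb.lean`: under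
`HardPRGExist` no natural property proves it) is completed here by the other half of the
Razborov–Rudich picture, now a tree theorem
(`Literature.Barriers.PneNP.HardPRGExist.not_NP_subset_PPoly`, `NaturalProofsHardPRGStrength.lean`):
the barrier's hypothesis `HardPRGExist` (a `2^{k^ε}`-hard PRG family in `P/poly`) itself IMPLIES
the crux. So, conditionally on `HardPRGExist`:

* `windowHam_of_hardPRGExist` — `WindowHam` holds (the item closed modulo the registered
  conjecture `HardPRGExist`, which sits above `CircuitThesis` in the conjecture web);
* `windowHam_and_no_naturalProof_of_hardPRGExist` — … and no natural proof establishes it;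
* `circuitThesis_of_hardPRGExist`, `rigidBenchmark_of_hardPRGExist` — the same for the sibling
  cruxes `Circuit.CircuitThesis` (stmt-PneNP-10624) and `RigidBenchmark` (stmt-PneNP-2149);
* `not_hardPRGExist_of_not_windowHam` — contrapositive: refuting the crux refutes `HardPRGExist`
  (and with it subexponentially hard one-way functions in the RR/Arora–Barak sense);
* `pneNP_of_hardPRGExist` — the summit under the hypothesis (the non-uniform form of
  "pseudo-random generators imply `P ≠ NP`").

All proofs are one-liners over landed modules; the mathematics is in
`HardPRGExist.not_NP_subset_PPoly`.
-/

namespace Summit.PneNP.PneNP.Theorems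

open Literature.Computability.Complexity Literature.Computability.MetaComplexity Literature.Barriers.PneNP Filter
open Summit.PneNP.PneNP.Theses.SymmetryBudget (WindowHam RigidBenchmark)
open Summit.PneNP.PneNP.Theses.Circuit (CircuitThesis)

/-- **The crux under the natural-proofs hypothesis.** If a `2^{k^ε}`-hard pseudo-random generator
family in `P/poly` exists (`HardPRGExist`, Razborov–Rudich 1997, Thm. 4.1, hypothesis), then
`WindowHam` holds: `HardPRGExist → NP ⊄ P/poly` (`HardPRGExist.not_NP_subset_PPoly`) and
`WindowHam ↔ NP ⊄ P/poly` (`windowHam_iff_not_np_subset_PPoly`). -/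
theorem windowHam_of_hardPRGExist (hG : HardPRGExist) : WindowHam :=
  windowHam_iff_not_np_subset_PPoly.2 hG.not_NP_subset_PPoly

/-- **True but not naturally provable.** Under `HardPRGExist` the crux `WindowHam` holds AND no
natural property (P/poly-constructive, large, useful against P/poly) together with an `NP`
language it applies to infinitely often exists — the two halves of the Razborov–Rudich picture
for this item (`windowHam_of_hardPRGExist`, `windowHam_naturalProofs_barrier`). -/
theorem windowHam_and_no_naturalProof_of_hardPRGExist (hG : HardPRGExist) :
    WindowHam ∧ ¬ ∃ (Q : CombinatorialProperty) (L : Language Bool),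
      IsNaturalProof Q ∧ L ∈ Nondeterministic.NP ∧ ∃ᶠ n in atTop, L.sliceFn n ∈ Q n :=
  ⟨windowHam_of_hardPRGExist hG, windowHam_naturalProofs_barrier hG⟩

/-- **Contrapositive.** A refutation of the crux (`¬ WindowHam`, i.e. `NP ⊆ P/poly`) refutes the
natural-proofs hypothesis: no `2^{k^ε}`-hard PRG family in `P/poly` would exist. -/
theorem not_hardPRGExist_of_not_windowHam (h : ¬ WindowHam) : ¬ HardPRGExist :=
  fun hG => h (windowHam_of_hardPRGExist hG)

/-- The sibling crux `CircuitThesis` (route `PneNP/Circuit`, item stmt-PneNP-10624, literally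
`¬ (NP ⊆ P/poly)`) under the natural-proofs hypothesis. -/
theorem circuitThesis_of_hardPRGExist (hG : HardPRGExist) : CircuitThesis :=
  circuitThesis_of_windowHam (windowHam_of_hardPRGExist hG)

/-- The sibling crux `RigidBenchmark` (this route, item stmt-PneNP-2149) under the natural-proofs
hypothesis. -/
theorem rigidBenchmark_of_hardPRGExist (hG : HardPRGExist) : RigidBenchmark :=
  rigidBenchmark_of_windowHam (windowHam_of_hardPRGExist hG)

/-- **The summit under the natural-proofs hypothesis**: `HardPRGExist → P ≠ NP` (through
`WindowHam`, `pneNP_of_windowHam`; the non-uniform form of "pseudo-random generators secure against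
polynomial-size circuits imply `P ≠ NP`"). -/
theorem pneNP_of_hardPRGExist (hG : HardPRGExist) : _root_.PneNP :=
  pneNP_of_windowHam (windowHam_of_hardPRGExist hG)

end Summit.PneNP.PneNP.Theorems
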